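import Summits.ResolutionOfSingularities.ResolutionOfSingularities.Theorems.EquisingularLiftEquisingularLiftNatCarrierDeltaStalks
import Summits.ResolutionOfSingularities.ResolutionOfSingularities.Theorems.EquisingularLiftEquisingularLiftNatDoubledConeSaturation
import Summits.ResolutionOfSingularities.ResolutionOfSingularities.Theorems.EquisingularLiftEquisingularLiftNatStrictTransformSupport
import HarnessLib

/-!
# [OURS · L1 W4.5(b) · EL♮] T-E1-CONE, piece (E-c): clause (e) E1 for in-carrier centres — a point of the exceptional
# line of a doubled-plane cone lies on the strict transform of the surface (stalk-chart assembly)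

Crux `EquisingularLiftNat` = stmt-ResolutionOfSingularities-20038 (route `EquisingularLift`, chain w45b), line `sections`, stub
`stub_elnat_three_isolated_nonabs` (child EL♮(3) stmt-ResolutionOfSingularities-20148); helper `--supports … --as helper` by
res-L1-w45b-stub-1 (T-E1-CONE (E-c), 2026-08-27). OURS; replaces the role of NOTHING in H. Hironaka's manuscript and is NOT a
statement of it; AI-written kernel lemma, weaker than expert review.

THE CLAUSE. A HorizChainE1 step (res-L1-w45b-lead-2 currency, p500485) with centre `C` on `X'` over the stage `τ : X' → X`
(blow-up along `J`, e.g. `J = s.ker` a section) needs (e) «`supp C ∩ X'_k ⊆ S' = closure τ⁻¹(Y ∖ V(J))`», `Y = V(K)` the running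
strict transform downstairs. For IN-CARRIER centres (`…NatInCarrierCentre`, R1-IN-CARRIER p508234; the Δ-centres of
T-CARRIER-Δ, res-type-100 p509910) the special-fibre points `x'` lie over `s₀ ∈ V(J)` and are read through res-L1-w45b-stub-2's
dictionary `χ : R[I/c_j] → 𝒪_{X',x'}`, `𝒪_{X',x'} ≅ R[I/c_j]_𝔔` (p506193; `R = 𝒪_{X,s₀}`, `I = J_{s₀} = (c)`). This file turns
the RING inequality of (E-a) into the SET membership (e):

* `stalkIdeal_strictTransformIdeal_le_maximalIdeal_of_saturation_le` — for ANY `K` with `K_{s₀} = (k)` (a set of generators in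
  `R`) and any dictionary `(j, 𝔔, χ, e)` at `x'`: if the `c_j`-saturation of `(k)·R[I/c_j]` lies in `𝔔`, then the stalk at `x'`
  of the schematic strict transform `strictTransformIdeal τ J K` lies in `𝔪_{x'}` (stalk = saturation, `stalkIdeal_strictTransformIdeal`
  (BlowupSNC) + `Ideal.map_colon_of_fg` (colons commute with the localisation `χ`, Atiyah–Macdonald 3.15) +
  `IsLocalization.AtPrime.map_eq_maximalIdeal`);
* `mem_strictTransformSet_of_saturation_le` — hence `x' ∈ closure τ⁻¹(supp K ∖ supp J)` (by (E-b)
  `support_strictTransformIdeal_subset`, p511213);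
* **`mem_strictTransformSet_of_doubledPlaneCone`** — with `K_{s₀} = (ϖ, F)`, `F ≡ u·c_{j₀}² (mod I³ + ϖR)` (DOUBLED CARRIER
  PLANE `{c_{j₀} = 0}`; `c` and `c mod ϖ` quasi-regular with domain quotients, `ū ∉ Ī`) and `x'` on the special fibre of the
  exceptional line of the carrier (`c_{j₀}/c_j ∈ 𝔔`, `ϖ/1 ∈ 𝔔`, `j ≠ j₀`): **`x' ∈ closure τ⁻¹(supp K ∖ supp J)`** — by (E-a)
  `saturation_le_of_exceptionalLine_le` (p510548). This is clause (e) for the `O`-line `ℓ̃ = E_s ∩ St(Π̃)` of the quartic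
  specimen `x₀²x₃² + x₁⁴ + x₂⁴` (T-ISO-1: cone `x₀²`) and for every «cone = doubled carrier plane» point; combined with
  res-type-100's `exists_stalk_strictTransformIdeal_sup_comap` (Φ linear) / `support_inCarrier` it gives
  `supp C ∩ X'_k ⊆ S'` pointwise.
* (rev 2) `stalkIdeal_strictTransformIdeal_eq_map_iSup_colon` (the stalk IS the localised chart saturation) and
  `mem_support_strictTransformIdeal_iff_saturation_le` (the support as an IFF on the chart) — inputs for T-TCONE.
References: Atiyah–Macdonald Cor. 3.15; The Stacks Project, Tag 0804; Görtz–Wedhorn (13.19).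
-/

set_option linter.dupNamespace false -- mandated namespace `Summit.<Summit>.<Problem>` of this single-conjunct summit

noncomputable section

open CategoryTheory AlgebraicGeometry TopologicalSpace IsLocalRing
open Literature.AlgebraicGeometry.Resolution

namespace Summit.ResolutionOfSingularities.ResolutionOfSingularities.Cruxes.EquisingularLiftNat.Sections

universe u

variable {X X' : Scheme.{u}} {τ : X' ⟶ X} {J : X.IdealSheafData}

set_option maxHeartbeats 400000 in -- the chart algebra `blowupAlgebra` is a subalgebra of a localisation: slow instance unification (cf. p506193, p509910)
/-- **The stalk of the schematic strict transform lies in `𝔪_{x'}` when the chart saturation lies in `𝔔`.** Setting: `X'` locally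
Noetherian, `τ : X' → X`, ideal sheaves `J` (centre) and `K` on `X`, `x' ∈ X'`; at `R = 𝒪_{X,τ x'}`: `J_{τ x'} = (c)`,
`K_{τ x'} = (k)`; a dictionary `(j, 𝔔, χ, e)` presenting `𝒪_{X',x'}` as `R[I/c_j]_𝔔` along `χ ⊇ τ^♯_{x'}` (p506193). If every
`g ∈ R[I/c_j]` with `c_jᴺ g ∈ (k)·R[I/c_j]` for some `N` lies in `𝔔`, then `(strictTransformIdeal τ J K)_{x'} ⊆ 𝔪_{x'}`.
[cite: AtiyahMacdonald1969, Cor. 3.15] -/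
theorem stalkIdeal_strictTransformIdeal_le_maximalIdeal_of_saturation_le [IsLocallyNoetherian X']
    (K : X.IdealSheafData) (x' : X') {r : ℕ} (c : Fin r → X.presheaf.stalk (τ x'))
    (hcJ : Ideal.span (Set.range c) = stalkIdeal J (τ x')) (k : Set (X.presheaf.stalk (τ x')))
    (hK : stalkIdeal K (τ x') = Ideal.span k) (j : Fin r)
    (𝔔 : PrimeSpectrum (blowupAlgebra (Ideal.span (Set.range c)) (c j)))
    (χ : blowupAlgebra (Ideal.span (Set.range c)) (c j) →+* X'.presheaf.stalk x')
    (e : X'.presheaf.stalk x' ≃+* Localization.AtPrime 𝔔.asIdeal)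
    (hχ : ∀ a, χ (algebraMap _ _ a) = (τ.stalkMap x').hom a)
    (he : ∀ b, e (χ b) = algebraMap _ (Localization.AtPrime 𝔔.asIdeal) b)
    (hsat : ∀ (g : blowupAlgebra (Ideal.span (Set.range c)) (c j)) (N : ℕ),
      algebraMap _ (blowupAlgebra (Ideal.span (Set.range c)) (c j)) (c j) ^ N * g ∈
        (Ideal.span k).map (algebraMap _ (blowupAlgebra (Ideal.span (Set.range c)) (c j))) → g ∈ 𝔔.asIdeal) :
    stalkIdeal (strictTransformIdeal τ J K) x' ≤ maximalIdeal (X'.presheaf.stalk x') := by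
  letI := χ.toAlgebra
  haveI : IsLocalization.AtPrime (X'.presheaf.stalk x') 𝔔.asIdeal := isLocalization_stalk_of_ringEquiv 𝔔 x' χ e he
  have hstalkMap : (τ.stalkMap x').hom = χ.comp (algebraMap _ (blowupAlgebra (Ideal.span (Set.range c)) (c j))) :=
    RingHom.ext fun a => (hχ a).symm
  have halg : (algebraMap (blowupAlgebra (Ideal.span (Set.range c)) (c j)) (X'.presheaf.stalk x')) = χ := rfl
  -- the stalk of the exceptional ideal is `(χ (c_j/1))`
  have hE : stalkIdeal (J.comap τ) x' =
      (Ideal.span {algebraMap _ (blowupAlgebra (Ideal.span (Set.range c)) (c j)) (c j)}).map χ := by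
    rw [stalkIdeal_comap_eq_map_stalkMap, ← hcJ, hstalkMap, ← Ideal.map_map,
      map_blowupAlgebra_eq_span (Ideal.subset_span (Set.mem_range_self j))]
  -- the stalk of `K·𝒪_{X'}` is `((k)·R[I/c_j])·𝒪_{X',x'}`; the strict transform's stalk is the saturation
  rw [stalkIdeal_strictTransformIdeal, hE, hK, hstalkMap, ← Ideal.map_map]
  refine iSup_le fun n => ?_
  -- colons commute with the localisation `χ`
  rw [← Ideal.map_pow, ← halg, ← Ideal.map_colon_of_fg 𝔔.asIdeal.primeCompl (X'.presheaf.stalk x') _ _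
    (Submodule.FG.pow ⟨{algebraMap _ (blowupAlgebra (Ideal.span (Set.range c)) (c j)) (c j)}, by simp⟩ n), halg,
    ← IsLocalization.AtPrime.map_eq_maximalIdeal 𝔔.asIdeal (X'.presheaf.stalk x'), halg]
  refine Ideal.map_mono fun g hg => hsat g n ?_
  rw [mem_colon_span_singleton_pow_iff] at hg
  rwa [mul_comm] at hg

/-- **Hence the point lies on the set-theoretic strict transform**: under the hypotheses of
`stalkIdeal_strictTransformIdeal_le_maximalIdeal_of_saturation_le`, `x' ∈ closure τ⁻¹(supp K ∖ supp J)` ((E-b)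
`support_strictTransformIdeal_subset`). [folklore] -/
theorem mem_strictTransformSet_of_saturation_le [IsLocallyNoetherian X']
    (K : X.IdealSheafData) (x' : X') {r : ℕ} (c : Fin r → X.presheaf.stalk (τ x'))
    (hcJ : Ideal.span (Set.range c) = stalkIdeal J (τ x')) (k : Set (X.presheaf.stalk (τ x')))
    (hK : stalkIdeal K (τ x') = Ideal.span k) (j : Fin r)
    (𝔔 : PrimeSpectrum (blowupAlgebra (Ideal.span (Set.range c)) (c j)))
    (χ : blowupAlgebra (Ideal.span (Set.range c)) (c j) →+* X'.presheaf.stalk x')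
    (e : X'.presheaf.stalk x' ≃+* Localization.AtPrime 𝔔.asIdeal)
    (hχ : ∀ a, χ (algebraMap _ _ a) = (τ.stalkMap x').hom a)
    (he : ∀ b, e (χ b) = algebraMap _ (Localization.AtPrime 𝔔.asIdeal) b)
    (hsat : ∀ (g : blowupAlgebra (Ideal.span (Set.range c)) (c j)) (N : ℕ),
      algebraMap _ (blowupAlgebra (Ideal.span (Set.range c)) (c j)) (c j) ^ N * g ∈
        (Ideal.span k).map (algebraMap _ (blowupAlgebra (Ideal.span (Set.range c)) (c j))) → g ∈ 𝔔.asIdeal) :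
    x' ∈ closure (τ ⁻¹' ((K.support : Set X) \ (J.support : Set X))) := by
  apply support_strictTransformIdeal_subset τ J K
  exact (mem_support_iff_stalkIdeal_le _ x').mpr
    (stalkIdeal_strictTransformIdeal_le_maximalIdeal_of_saturation_le K x' c hcJ k hK j 𝔔 χ e hχ he hsat)

/-- **T-E1-CONE: clause (e) for the exceptional line of a doubled-plane cone.** Let `X'` be locally Noetherian, `τ : X' → X`,
`J`, `K` ideal sheaves on `X`, `x' ∈ X'`; at `R = 𝒪_{X,τ x'}`: `J_{τ x'} = (c)` with `c` quasi-regular and `R/(c)` a domain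
(the regular centre, e.g. a section), `ϖ ∉ (c)` with `c mod ϖ` quasi-regular and `(R/ϖ)/(c̄)` a domain (the uniformizer),
`K_{τ x'} = (ϖ, F)` with `F ≡ u·c_{j₀}² (mod (c)³ + ϖR)`, `ū ∉ (c̄)` (the running strict transform `V(K)` is, near `τ x'`, a
hypersurface of the special fibre whose tangent cone is the DOUBLED CARRIER PLANE `{c_{j₀} = 0}`). If `x'`, read through a
dictionary `(j, 𝔔, χ, e)` with `j ≠ j₀`, lies on the special fibre of the exceptional line of the carrier (`c_{j₀}/c_j ∈ 𝔔`,
`c_j/1 ∈ 𝔔`, `ϖ/1 ∈ 𝔔`), then `x'` lies on the strict transform `closure τ⁻¹(supp K ∖ supp J)`. [folklore; OURS assembly] -/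
theorem mem_strictTransformSet_of_doubledPlaneCone [IsLocallyNoetherian X']
    (K : X.IdealSheafData) (x' : X') {r : ℕ} (c : Fin r → X.presheaf.stalk (τ x'))
    (hcJ : Ideal.span (Set.range c) = stalkIdeal J (τ x')) (hc : IsQuasiRegular c)
    [IsDomain (X.presheaf.stalk (τ x') ⧸ Ideal.span (Set.range c))]
    {ϖ F u : X.presheaf.stalk (τ x')} (hϖ : ϖ ∉ Ideal.span (Set.range c))
    (hcbar : IsQuasiRegular fun l => Ideal.Quotient.mk (Ideal.span {ϖ}) (c l))
    [IsDomain ((X.presheaf.stalk (τ x') ⧸ Ideal.span {ϖ}) ⧸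
      Ideal.span (Set.range fun l => Ideal.Quotient.mk (Ideal.span {ϖ}) (c l)))]
    (j₀ : Fin r) (hu : Ideal.Quotient.mk (Ideal.span {ϖ}) u ∉
      Ideal.span (Set.range fun l => Ideal.Quotient.mk (Ideal.span {ϖ}) (c l)))
    (hF : F - u * c j₀ ^ 2 ∈ Ideal.span (Set.range c) ^ 3 ⊔ Ideal.span {ϖ})
    (hK : stalkIdeal K (τ x') = Ideal.span {ϖ, F}) (j : Fin r) (hj : j₀ ≠ j)
    (𝔔 : PrimeSpectrum (blowupAlgebra (Ideal.span (Set.range c)) (c j)))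
    (χ : blowupAlgebra (Ideal.span (Set.range c)) (c j) →+* X'.presheaf.stalk x')
    (e : X'.presheaf.stalk x' ≃+* Localization.AtPrime 𝔔.asIdeal)
    (hχ : ∀ a, χ (algebraMap _ _ a) = (τ.stalkMap x').hom a)
    (he : ∀ b, e (χ b) = algebraMap _ (Localization.AtPrime 𝔔.asIdeal) b)
    (hfrac : blowupAlgebra.frac c j j₀ ∈ 𝔔.asIdeal)
    (hcj : algebraMap _ (blowupAlgebra (Ideal.span (Set.range c)) (c j)) (c j) ∈ 𝔔.asIdeal)
    (hϖQ : algebraMap _ (blowupAlgebra (Ideal.span (Set.range c)) (c j)) ϖ ∈ 𝔔.asIdeal) :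
    x' ∈ closure (τ ⁻¹' ((K.support : Set X) \ (J.support : Set X))) :=
  mem_strictTransformSet_of_saturation_le K x' c hcJ {ϖ, F} hK j 𝔔 χ e hχ he fun _ _ hg =>
    saturation_le_of_exceptionalLine_le c j j₀ hj hc hϖ hcbar hu hF 𝔔.asIdeal hfrac hcj hϖQ hg


/-! ## rev 2 (append-only): the stalk of the strict transform READ EXACTLY on the chart, and the support as an iff -/

set_option maxHeartbeats 400000 in -- the chart algebra `blowupAlgebra` is a subalgebra of a localisation: slow instance unification (cf. p506193, p509910)
/-- **The stalk of the schematic strict transform is the localised chart saturation**: with a dictionary `(j, 𝔔, χ, e)` at `x'`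
and `K_{τ x'} = (k)`, `(strictTransformIdeal τ J K)_{x'} = (⨆ₙ ((k)·R[I/c_j] : c_jⁿ))·𝒪_{X',x'}` (extension along `χ`).
[cite: AtiyahMacdonald1969, Cor. 3.15] -/
theorem stalkIdeal_strictTransformIdeal_eq_map_iSup_colon [IsLocallyNoetherian X']
    (K : X.IdealSheafData) (x' : X') {r : ℕ} (c : Fin r → X.presheaf.stalk (τ x'))
    (hcJ : Ideal.span (Set.range c) = stalkIdeal J (τ x')) (k : Set (X.presheaf.stalk (τ x'))) (hK : stalkIdeal K (τ x') = Ideal.span k)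
    (j : Fin r) (𝔔 : PrimeSpectrum (blowupAlgebra (Ideal.span (Set.range c)) (c j)))
    (χ : blowupAlgebra (Ideal.span (Set.range c)) (c j) →+* X'.presheaf.stalk x')
    (e : X'.presheaf.stalk x' ≃+* Localization.AtPrime 𝔔.asIdeal)
    (hχ : ∀ a, χ (algebraMap _ _ a) = (τ.stalkMap x').hom a)
    (he : ∀ b, e (χ b) = algebraMap _ (Localization.AtPrime 𝔔.asIdeal) b) :
    stalkIdeal (strictTransformIdeal τ J K) x' =
      (⨆ n : ℕ, Submodule.colon ((Ideal.span k).map (algebraMap _ (blowupAlgebra (Ideal.span (Set.range c)) (c j))))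
        ((Ideal.span {algebraMap _ (blowupAlgebra (Ideal.span (Set.range c)) (c j)) (c j)} ^ n :
          Ideal (blowupAlgebra (Ideal.span (Set.range c)) (c j))) : Set _)).map χ := by
  letI := χ.toAlgebra
  haveI : IsLocalization.AtPrime (X'.presheaf.stalk x') 𝔔.asIdeal := isLocalization_stalk_of_ringEquiv 𝔔 x' χ e he
  have hstalkMap : (τ.stalkMap x').hom = χ.comp (algebraMap _ (blowupAlgebra (Ideal.span (Set.range c)) (c j))) :=
    RingHom.ext fun a => (hχ a).symm
  have halg : (algebraMap (blowupAlgebra (Ideal.span (Set.range c)) (c j)) (X'.presheaf.stalk x')) = χ := rfl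
  have hE : stalkIdeal (J.comap τ) x' =
      (Ideal.span {algebraMap _ (blowupAlgebra (Ideal.span (Set.range c)) (c j)) (c j)}).map χ := by
    rw [stalkIdeal_comap_eq_map_stalkMap, ← hcJ, hstalkMap, ← Ideal.map_map,
      map_blowupAlgebra_eq_span (Ideal.subset_span (Set.mem_range_self j))]
  rw [stalkIdeal_strictTransformIdeal, hE, hK, hstalkMap, ← Ideal.map_map, Ideal.map_iSup]
  refine iSup_congr fun n => ?_
  rw [← Ideal.map_pow, ← halg, ← Ideal.map_colon_of_fg 𝔔.asIdeal.primeCompl (X'.presheaf.stalk x') _ _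
    (Submodule.FG.pow ⟨{algebraMap _ (blowupAlgebra (Ideal.span (Set.range c)) (c j)) (c j)}, by simp⟩ n)]

set_option maxHeartbeats 400000 in -- as above
/-- **Support of the schematic strict transform, read on the chart (iff)**: `x' ∈ supp (strictTransformIdeal τ J K)` iff the
`c_j`-saturation of `(k)·R[I/c_j]` lies in `𝔔`. With `support_strictTransformIdeal_eq` (…NatStrictTransformSupport rev 2) this reads
the SET strict transform `closure τ⁻¹(supp K ∖ supp J)` at the points over the centre. [folklore] -/
theorem mem_support_strictTransformIdeal_iff_saturation_le [IsLocallyNoetherian X']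
    (K : X.IdealSheafData) (x' : X') {r : ℕ} (c : Fin r → X.presheaf.stalk (τ x'))
    (hcJ : Ideal.span (Set.range c) = stalkIdeal J (τ x')) (k : Set (X.presheaf.stalk (τ x'))) (hK : stalkIdeal K (τ x') = Ideal.span k)
    (j : Fin r) (𝔔 : PrimeSpectrum (blowupAlgebra (Ideal.span (Set.range c)) (c j)))
    (χ : blowupAlgebra (Ideal.span (Set.range c)) (c j) →+* X'.presheaf.stalk x')
    (e : X'.presheaf.stalk x' ≃+* Localization.AtPrime 𝔔.asIdeal)
    (hχ : ∀ a, χ (algebraMap _ _ a) = (τ.stalkMap x').hom a)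
    (he : ∀ b, e (χ b) = algebraMap _ (Localization.AtPrime 𝔔.asIdeal) b) :
    x' ∈ (strictTransformIdeal τ J K).support ↔
      ∀ (g : blowupAlgebra (Ideal.span (Set.range c)) (c j)) (N : ℕ),
        algebraMap _ (blowupAlgebra (Ideal.span (Set.range c)) (c j)) (c j) ^ N * g ∈
          (Ideal.span k).map (algebraMap _ (blowupAlgebra (Ideal.span (Set.range c)) (c j))) → g ∈ 𝔔.asIdeal := by
  letI := χ.toAlgebra
  haveI : IsLocalization.AtPrime (X'.presheaf.stalk x') 𝔔.asIdeal := isLocalization_stalk_of_ringEquiv 𝔔 x' χ e he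
  have halg : (algebraMap (blowupAlgebra (Ideal.span (Set.range c)) (c j)) (X'.presheaf.stalk x')) = χ := rfl
  have hunder : Ideal.comap χ (maximalIdeal (X'.presheaf.stalk x')) = 𝔔.asIdeal := by
    rw [← halg]
    exact IsLocalization.AtPrime.under_maximalIdeal (X'.presheaf.stalk x') 𝔔.asIdeal
  rw [mem_support_iff_stalkIdeal_le, stalkIdeal_strictTransformIdeal_eq_map_iSup_colon K x' c hcJ k hK j 𝔔 χ e hχ he,
    Ideal.map_le_iff_le_comap, hunder]
  constructor
  · intro h g N hg
    refine h (Ideal.mem_iSup_of_mem N ?_)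
    rw [mem_colon_span_singleton_pow_iff, mul_comm]
    exact hg
  · intro h
    refine iSup_le fun n g hg => h g n ?_
    rw [mem_colon_span_singleton_pow_iff] at hg
    rwa [mul_comm] at hg

end Summit.ResolutionOfSingularities.ResolutionOfSingularities.Cruxes.EquisingularLiftNat.Sections

end
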